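import Literature.Geometry.Riemannian.MetricFlowConcentration
import Mathlib.MeasureTheory.Integral.Average
import Mathlib.MeasureTheory.Integral.Lebesgue.Markov
import HarnessLib

/-!
# Existence of `H`-centers in an `H`-concentrated metric flow, and the mass of balls around them
# (Bamler 2023, §3.4, Proposition (existence of `H`-centers) and the Lemma following it)

R. Bamler, *Compactness theory of the space of super Ricci flows*, Invent. Math. 233 (2023), §3.4.
Proposition: "Suppose that `𝒳` is `H`-concentrated. Then for every `x ∈ 𝒳_t` and `s ∈ I`, `s ≤ t`,
there is an `H`-center `z ∈ 𝒳_s` of `x`. … Proof. We have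
`∫_{𝒳_s} Var(δ_z, ν_{x;s}) dν_{x;s}(z) = Var(ν_{x;s}) ≤ H(t − s)`, which implies the first
assertion." Lemma: "If `z ∈ 𝒳_s` is an `H`-center of `x ∈ 𝒳_t`, then for all `A > 0`,
`ν_{x;s}(B(z, √(A H (t − s)))) ≥ 1 − 1/A`."

Over `MetricFlowConcentration.lean` (`variance`, `IsHConcentrated`, `IsHCenter`) this file PROVES:

* `MetricFlow.IsHConcentrated.variance_condKernel_self_le_ofReal` — `Var(ν_{x;s}) ≤ H(t − s)`
  (`x₁ = x₂ = x` in the definition);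
* `lintegral_variance_dirac` — `∫ Var(δ_z, ν) dν(z) = Var(ν, ν)`;
* `MetricFlow.IsHConcentrated.exists_isHCenter` — **existence of `H`-centers** (first moment
  method `exists_le_lintegral`);
* `MetricFlow.IsHCenter.measure_ball_ge` — **the Lemma**, for `A > 0` and `H(t − s) > 0`
  (Markov's inequality; for `H(t − s) = 0` the printed open-ball statement degenerates — the ball
  has radius `0` — and is not asserted).

The second assertion of the Proposition (`d_s(z₁, z₂) ≤ 2√(H(t − s))` for two `H`-centers)
rests on the `√Var` triangle inequality of §2.2, which is not yet in the tree, and is NOT here.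

## References

* R. H. Bamler, *Compactness theory of the space of super Ricci flows*, Invent. Math. 233 (2023),
  1121–1277 (arXiv:2008.09298), §3.4, Proposition (existence of `H`-centers) with its proof, and
  the Lemma following it. [Bamler2023]
-/

noncomputable section

open Set MeasureTheory Filter TopologicalSpace Function
open scoped Topology ENNReal NNReal

namespace Literature.Geometry.Riemannian

section General

variable {X : Type*} [MetricSpace X] [MeasurableSpace X] [BorelSpace X]

/-- **`∫ Var(δ_z, ν) dν(z) = Var(ν, ν)`** (the identity in the proof of the existence of
`H`-centers, Bamler 2023, §3.4): both sides are `∫∫ d²(z, y) dν(y) dν(z)`.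
[cite: Bamler2023, §3.4, proof of the Proposition (existence of H-centers)] -/
theorem lintegral_variance_dirac (ν : Measure X) :
    ∫⁻ z, variance (Measure.dirac z) ν ∂ν = variance ν ν := by
  rw [variance_def]
  exact lintegral_congr fun z ↦ variance_dirac_left z ν

/-- `z ↦ Var(δ_z, ν) = ∫ d²(z, y) dν(y)` is measurable for s-finite `ν` on a separable metric space
(Tonelli measurability). [folklore] -/
theorem measurable_variance_dirac [SeparableSpace X] (ν : Measure X) [SFinite ν] :
    Measurable fun z : X ↦ variance (Measure.dirac z) ν := by
  haveI : SecondCountableTopology X := UniformSpace.secondCountable_of_separable X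
  simp_rw [variance_dirac_left]
  exact (measurable_edist.pow_const 2).lintegral_prod_right'

end General

namespace MetricFlow

universe u

variable {I : Set ℝ} {𝒳 : MetricFlow.{u} I} {H : ℝ}

/-- **`Var(ν_{x;s}) ≤ H(t − s)`** in an `H`-concentrated flow (the definition with `x₁ = x₂ = x`,
`d_t(x, x) = 0`; the inequality in the proof of the existence of `H`-centers, Bamler 2023, §3.4).
[cite: Bamler2023, §3.4, proof of the Proposition (existence of H-centers)] -/
theorem IsHConcentrated.variance_condKernel_self_le_ofReal (hH : 𝒳.IsHConcentrated H) {s t : I}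
    (hst : (s : ℝ) ≤ t) (x : 𝒳.Slice t) :
    variance (𝒳.condKernel x s) (𝒳.condKernel x s) ≤ ENNReal.ofReal (H * ((t : ℝ) - s)) := by
  have h := hH hst x x
  rwa [edist_self, zero_pow two_ne_zero, zero_add] at h

/-- **Existence of `H`-centers** (Bamler 2023, §3.4, Proposition: "Suppose that `𝒳` is
`H`-concentrated. Then for every `x ∈ 𝒳_t` and `s ∈ I`, `s ≤ t`, there is an `H`-center `z ∈ 𝒳_s`
of `x`"): since `∫ Var(δ_z, ν_{x;s}) dν_{x;s}(z) = Var(ν_{x;s}) ≤ H(t − s)` and `ν_{x;s}` is a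
probability measure, some `z` has `Var(δ_z, ν_{x;s}) ≤ H(t − s)` (first moment method).
[cite: Bamler2023, §3.4, Proposition (existence of H-centers)] -/
theorem IsHConcentrated.exists_isHCenter (hH : 𝒳.IsHConcentrated H) {s t : I} (hst : (s : ℝ) ≤ t)
    (x : 𝒳.Slice t) : ∃ z : 𝒳.Slice s, 𝒳.IsHCenter H z x := by
  haveI := 𝒳.isProbabilityMeasure_condKernel x hst
  obtain ⟨z, hz⟩ := exists_le_lintegral (μ := 𝒳.condKernel x s)
    (measurable_variance_dirac (𝒳.condKernel x s)).aemeasurable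
  refine ⟨z, hst, hz.trans ?_⟩
  rw [lintegral_variance_dirac]
  exact hH.variance_condKernel_self_le_ofReal hst x

/-- **Mass of balls around an `H`-center** (Bamler 2023, §3.4, Lemma after the Proposition: "If
`z ∈ 𝒳_s` is an `H`-center of `x ∈ 𝒳_t`, then for all `A > 0`,
`ν_{x;s}(B(z, √(A H(t − s)))) ≥ 1 − 1/A`"), for `H(t − s) > 0` (Markov's inequality:
`A H(t−s) · ν_{x;s}(𝒳_s ∖ B) ≤ ∫ d²(z, ·) dν_{x;s} = Var(δ_z, ν_{x;s}) ≤ H(t − s)`).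
[cite: Bamler2023, §3.4, Lemma after the Proposition (existence of H-centers)] -/
theorem IsHCenter.measure_ball_ge {s t : I} {z : 𝒳.Slice s} {x : 𝒳.Slice t}
    (hz : 𝒳.IsHCenter H z x) {A : ℝ} (hA : 0 < A) (hpos : 0 < H * ((t : ℝ) - s)) :
    ENNReal.ofReal (1 - 1 / A) ≤
      𝒳.condKernel x s (Metric.ball z (Real.sqrt (A * (H * ((t : ℝ) - s))))) := by
  haveI := 𝒳.isProbabilityMeasure_condKernel x hz.1
  set ν := 𝒳.condKernel x s with hν
  set c : ℝ := H * ((t : ℝ) - s) with hc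
  set r : ℝ := Real.sqrt (A * c) with hr
  have hAc : 0 < A * c := mul_pos hA hpos
  have hr2 : r ^ 2 = A * c := Real.sq_sqrt hAc.le
  -- Markov: `ofReal (A c) · ν(Bᶜ) ≤ Var(δ_z, ν) ≤ ofReal c`
  have hsub : (Metric.ball z r)ᶜ ⊆ {y | ENNReal.ofReal (A * c) ≤ edist z y ^ 2} := by
    intro y hy
    simp only [mem_compl_iff, Metric.mem_ball, not_lt] at hy
    show ENNReal.ofReal (A * c) ≤ edist z y ^ 2
    rw [edist_dist, ← ENNReal.ofReal_pow dist_nonneg, ← hr2, dist_comm]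
    exact ENNReal.ofReal_le_ofReal (pow_le_pow_left₀ (Real.sqrt_nonneg _) hy 2)
  have hmarkov := mul_meas_ge_le_lintegral₀ (μ := ν) (f := fun y ↦ edist z y ^ 2)
    (((measurable_edist_right (x := z)).pow_const 2).aemeasurable) (ENNReal.ofReal (A * c))
  have hV : ∫⁻ y, edist z y ^ 2 ∂ν ≤ ENNReal.ofReal c := hz.lintegral_edist_sq_le
  have h1 : ENNReal.ofReal (A * c) * ν (Metric.ball z r)ᶜ ≤ ENNReal.ofReal c :=
    ((mul_le_mul' le_rfl (measure_mono hsub)).trans hmarkov).trans hV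
  -- hence `ν(Bᶜ) ≤ 1/A`
  have h2 : ν (Metric.ball z r)ᶜ ≤ ENNReal.ofReal (1 / A) := by
    have hne : ENNReal.ofReal (A * c) ≠ 0 := by simpa [ENNReal.ofReal_eq_zero, not_le] using hAc
    calc ν (Metric.ball z r)ᶜ
        = (ENNReal.ofReal (A * c))⁻¹ * (ENNReal.ofReal (A * c) * ν (Metric.ball z r)ᶜ) := by
          rw [← mul_assoc, ENNReal.inv_mul_cancel hne ENNReal.ofReal_ne_top, one_mul]
      _ ≤ (ENNReal.ofReal (A * c))⁻¹ * ENNReal.ofReal c := mul_le_mul' le_rfl h1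
      _ = ENNReal.ofReal (1 / A) := by
          rw [← ENNReal.ofReal_inv_of_pos hAc, ← ENNReal.ofReal_mul (inv_nonneg.2 hAc.le)]
          congr 1
          field_simp
  -- and `ν(B) = 1 − ν(Bᶜ) ≥ 1 − 1/A`
  have h3 : ν (Metric.ball z r) = 1 - ν (Metric.ball z r)ᶜ := by
    have hB : MeasurableSet (Metric.ball z r) := Metric.isOpen_ball.measurableSet
    have := prob_compl_eq_one_sub (μ := ν) hB.compl
    rwa [compl_compl] at this
  rw [h3]
  calc ENNReal.ofReal (1 - 1 / A) = 1 - ENNReal.ofReal (1 / A) := by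
        rw [ENNReal.ofReal_sub _ (by positivity), ENNReal.ofReal_one]
    _ ≤ 1 - ν (Metric.ball z r)ᶜ := tsub_le_tsub_left h2 _

end MetricFlow

end Literature.Geometry.Riemannian

end
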